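import Summits.QuantumAdvantage.QuantumAdvantage.Theorems.CubicForrelationSignedExactCubicForrelationNotPrBPPFinderMachineLoops
import Summits.QuantumAdvantage.QuantumAdvantage.Theorems.CubicForrelationSignedCubicForrelationInPrBPPStubCertify
import Literature.Computability.Complexity.F2RowReductionRank
import Literature.Computability.QuantumComplexity.QuadraticFourierSamplerProofs

/-!
# Crux `CubicForrelation.SignedExactCubicForrelationNotPrBPP` (stmt-QuantumAdvantage-13932), line `dual-pingpong-frame`:
# the finder machine `findV2`, III — the machine, `findV2 ∈ FP` and its soundness `findV2_sound`

Support file (`--supports stmt-QuantumAdvantage-13932`) proving the registered sub-goals **`findV2_mem_FP`**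
and **`findV2_sound`** (sequel of `…FinderMachineBricks.lean`, `…FinderMachineLoops.lean`). The machine is
the lead's "finder v2" (two-tensor algebra-orbit closure), written as plain functions of the mirror instance
`t = (n, k, circuits)` (`ForrCode.Inst`) in the style of `CubicForrelationEstimatorMachine.lean` and certified
polynomial time by the typed algebra `CodeFP` (Arora–Barak 2009, §1.3); the `FP` string function `findV2` is
the witness of `findI_codeFP` (by choice, as `CubicDequant.accF`), so it agrees with
`findCore (instOf I) |encode I|` on every instance code (`findV2_encode`). SOUNDNESS (`findV2_sound`): a
non-empty output `L` passed `MMReadout.certOK` (rank `n/2` by row reduction, and all second differences of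
`g` along two rows vanish at `0` and the unit vectors), hence its row span `V(L)` read back in `{0,1}ⁿ`
contains `0`, is `⊕`-closed, has `|V(L)|² = 2ⁿ` (`card_VL`: `|V(L)| = 2^{rank}` by
`F2Elim.finrank_rowSpan_eq_card_pivs`), and — `g` being cubic — `D_uD_v g ≡ 0` for all `u, v ∈ V(L)`
(`stub_certify` of the sibling crux stmt-13933: two derivatives of a cubic are affine, an affine function
vanishing at `0` and the `eᵢ` vanishes, cocycle identity from rows to the span). Completeness (the
certification passes on every exact Maiorana–McFarland pair) is the lead's open stub and is NOT claimed here.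

**The algorithm** (`findCore`; `n = 2m`, `f = C₀`, `g = C₁`; guard `k = 2 ∧ n ≤ |x| + 1`, else output `[]`;
under the guard the effective dimension `CubicDequant.nEff` is `n`). Context `Γ = (n, m, β, C₁, T, Bs, As)`
(`ctxOf`): `T = tensorOf n C₁` the third-derivative tensor of `g` (`T[i][j][k] = D_{eᵢ}D_{eⱼ}D_{e_k} g(0)`, eight
evaluations, `d3`), `Bs` / `As` the unit slices `B_{e_j}` of the tensors of `g` / `f`, `β = 8(n+1)³` the
enumeration budget.
1. SEEDS (`seedsOf`, file I): for each unit probe `eᵢ`, the kernel basis of `B_{eᵢ}` (the radical) followed by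
   the first `min(2^d, β)` elements of its span, keeping the `u ≠ 0` with `2·dim ker B_u ≥ n` (rank test).
2. ORBIT of a seed (`orbitOf`, file I): `m+1` rounds `S ↦ basis(S ++ [A_z(B_w v) : v ∈ S, w, z < n])`, frozen
   (FAILED) once `dim > m`.
3. CERTIFIED(`S`) (`certMid`): `0 < |S| ≤ m`, ISO `Σ_{i,j} uᵢvⱼT[i][j][·] = 0` for all rows `u, v` (`isoOK`), and
   COSET-AFFINE: `D_uD_v g` vanishes at `0` and at the unit vectors for all rows (`affOK`, the test of
   `MMReadout.certOK`).
4. GREEDY MERGE (`mergeAll`): over the seeds `s`: skip if `|S| = m` or `s ∈ span S`; `O := orbit(s)`; skip unless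
   `O` is certified and not failed; `C := basis(S ++ O)`; `S := C` if `|C| ≤ m` and `C` certified.
5. DESCENT (`descAll`, `m` rounds of `descStep`): while `0 < |S| < m`: `E :=` kernel basis of the stacked slices
   `[B_s]_{s ∈ S}` (`= ∩_s R_s`, `stackE`), `r := |E| - m` (as `|E.drop m|`); stop if `|E| < m` or `2^{r+1} > β`; `comp :=` the rows
   of `E` outside `span S` (greedy, `complOf`); the first `v` among the `2^{r+1}` combinations of the first `r+1`
   of them with `v ≠ 0`, `v ∉ span S`, rank test, non-failed orbit `O` and certified `C := basis(S ++ O)` of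
   `dim ≤ m` gives `S := C` (`tryVec`); if none, `S` is unchanged (and so are all later rounds).
6. OUTPUT (`outRows`): `S` if `|S| = m`, `S` is certified AND passes `MMReadout.certOK n C₁ S` (rank `n/2` by row
   reduction + the coset-affine test); otherwise `[]`. Soundness only ever uses this last check.
Deviations from the lead's SPEC (all on the completeness-neutral side, documented for the completeness proof):
the log-caps "dim ≤ 3⌈log₂(n+1)⌉" are replaced by the budget `2^d ≤ β = 8(n+1)³` (same order), and the probe
seeds always contain the radical basis AND the budgeted prefix of its span (a superset of the SPEC's pool);
loops run a fixed number of rounds and freeze instead of breaking; bases are normalised to length `n`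
(`normV`) and the complement list is capped at `n` rows — both idle on genuine runs.

## References

* S. Arora, B. Barak, *Computational Complexity: A Modern Approach*, CUP 2009, §1.3. [AroraBarak2009]
* C. Carlet, *Boolean Functions for Cryptography and Coding Theory*, CUP 2021, Prop. 54 (M-subspaces of the
  completed Maiorana–McFarland class). [Carlet2020]
* A. Kipnis, A. Shamir, *Cryptanalysis of the HFE public key cryptosystem by relinearization*, CRYPTO 1999, §4
  (kernel / invariant-subspace search from pencils of forms). [KipnisShamir1999]
-/

noncomputable section

set_option linter.dupNamespace false -- D-0017: single-problem summit ⇒ `QuantumAdvantage.QuantumAdvantage` by design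

namespace Summit.QuantumAdvantage.QuantumAdvantage.Theorems.SignedExactCubicForrelationNotPrBPP.FinderMachine

open _root_.Computability Literature.Computability.Complexity Literature.Computability.Complexity.CodeFP
open Literature.Computability.QuantumComplexity
open Literature.Computability.Complexity.F2Elim (bxorL Row rrun isPiv prow kvec bitsE stCE)
open ForrCode QuadSampler CubicDequant MMReadout

/-! ### The machine: tensor, context, output rule, guard -/

/-- **The output rule**: the rows only if `|S| = m`, certified, and `MMReadout.certOK` passes. [cite: Carlet2020, Prop. 54] -/
def outRows (Γ : Ctx) (S : Mat) : Mat := if decide (S.length = cm Γ) && certMid Γ S && certOK (cn Γ) (cc Γ) S then S else []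

/-- The run in a context: seeds, merge, descent, output rule. [folklore] -/
def runCtx (Γ : Ctx) : Mat := outRows Γ (descAll Γ (mergeAll Γ (seedsOf (cn Γ) (cbud Γ) (cT Γ))))

/-- The third difference `D_{eᵢ}D_{eⱼ}D_{e_k} c (0)` of a circuit (eight evaluations, via two second
differences). [cite: Carlet2020, Prop. 54] -/
def d3 (n : ℕ) (c : PCirc) (i j k : ℕ) : Bool := (d2 c (zeroL n) (unitL n i) (unitL n j) ^^ d2 c (unitL n k) (unitL n i) (unitL n j))

/-- **The third-derivative tensor** `T[i][j][k]` of a circuit on `n` bits. [cite: Carlet2020, Prop. 54] -/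
def tensorOf (n : ℕ) (c : PCirc) : Ten :=
  (List.range n).map fun i => (List.range n).map fun j => (List.range n).map fun k => d3 n c i j k

/-- The unit slices `B_{e_j}`, `j < n`, of a tensor. [folklore] -/
def unitSlices (n : ℕ) (T : Ten) : List Mat := (List.range n).map fun j => sliceT n T (unitL n j)

/-- The budget polynomial `8 (X + 1)³`. [folklore] -/
def budP : Polynomial ℕ := 8 * (Polynomial.X + 1) ^ 3

/-- **The context of an instance**: `(n, n/2, 8(n+1)³, C₁, T_g, unit slices of T_g, unit slices of T_f)`. [folklore] -/
def ctxOf (n : ℕ) (c₀ c₁ : PCirc) : Ctx :=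
  (n, (n / 2, (budP.eval n, (c₁, (tensorOf n c₁, (unitSlices n (tensorOf n c₁), unitSlices n (tensorOf n c₀)))))))

/-- **The finder on a mirror instance** `t` with code length `ℓ`: guard `k = 2 ∧ n ≤ ℓ + 1`, then the run in
the context of `(nEff t ℓ, C₀, C₁)`; `[]` off the guard. [folklore] -/
def findCore (t : Inst) (ℓ : ℕ) : Mat :=
  if decide (t.2.1 = 2) && decide (t.1 ≤ ℓ + 1) then runCtx (ctxOf (nEff t ℓ) (circAt t 0) (circAt t 1)) else []

/-! ### Polynomial time and the `FP` witness -/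

/-- **The run on codes**: `Γ ↦ runCtx Γ`. [cite: AroraBarak2009, §1.3] -/
theorem runCtx_codeFP : CodeFP ctxE matE runCtx := by
  obtain ⟨cN, cM, cBud, cC, cTT, -, -⟩ := ctx_codeFP
  have hseeds := seedsOf_codeFP.comp ((cN.pair cBud).pair cTT)
  have hS := descMerge_codeFP.comp ((CodeFP.id ctxE).pair hseeds)
  have hc := ((natEq.comp (((natLength bitsE).comp hS).pair (natOfUn.comp cM))).and (certMid_codeFP.comp ((CodeFP.id ctxE).pair hS))).and
    (certOK_codeFP.comp (cN.pair (cC.pair hS)))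
  exact (hc.ite hS (const _ [])).congr fun _ => rfl

/-- The code of the second-difference context of `d3`: `((n, c), (i, (j, k)))`. [folklore] -/
abbrev D3E : (ℕ × PCirc) × (ℕ × (ℕ × ℕ)) → List Bool := pairE (pairE unE pcE) (pairE natE (pairE natE natE))

/-- Third differences on codes. [cite: AroraBarak2009, §1.3] -/
theorem d3_codeFP : CodeFP D3E bitE (fun t => d3 t.1.1 t.1.2 t.2.1 t.2.2.1 t.2.2.2) := by
  have hn : CodeFP D3E unE (fun t => t.1.1) := (fst _ _).fst'
  have hc : CodeFP D3E pcE (fun t => t.1.2) := (fst _ _).snd'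
  have hi := unitL_codeFP.comp (hn.pair (snd (pairE unE pcE) (pairE natE (pairE natE natE))).fst')
  have hj := unitL_codeFP.comp (hn.pair (snd (pairE unE pcE) (pairE natE (pairE natE natE))).snd'.fst')
  have hk := unitL_codeFP.comp (hn.pair (snd (pairE unE pcE) (pairE natE (pairE natE natE))).snd'.snd')
  have h1 := d2_codeFP.comp (hc.pair ((zeroL_codeFP.comp hn).pair (hi.pair hj)))
  have h2 := d2_codeFP.comp (hc.pair (hk.pair (hi.pair hj)))
  exact (h1.xor h2).congr fun _ => rfl

/-- **The tensor on codes**: `(n, c) ↦ tensorOf n c` (three nested maps). [cite: AroraBarak2009, §1.3] -/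
theorem tensorOf_codeFP : CodeFP (pairE unE pcE) tenE (fun t => tensorOf t.1 t.2) := by
  -- innermost: context `(((n, c), i), j)`, item `k` (compositions elaborated before they meet an expected type)
  have hn : CodeFP (pairE (pairE (pairE (pairE unE pcE) natE) natE) natE) unE (fun q => q.1.1.1.1) := (fst _ _).fst'.fst'.fst'
  have hc : CodeFP (pairE (pairE (pairE (pairE unE pcE) natE) natE) natE) pcE (fun q => q.1.1.1.2) := (fst _ _).fst'.fst'.snd'
  have hi : CodeFP (pairE (pairE (pairE (pairE unE pcE) natE) natE) natE) natE (fun q => q.1.1.2) := (fst _ _).fst'.snd'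
  have hj : CodeFP (pairE (pairE (pairE (pairE unE pcE) natE) natE) natE) natE (fun q => q.1.2) := (fst _ _).snd'
  have hk : CodeFP (pairE (pairE (pairE (pairE unE pcE) natE) natE) natE) natE (fun q => q.2) := snd _ _
  have hd := d3_codeFP.comp ((hn.pair hc).pair (hi.pair (hj.pair hk)))
  have hin := CodeFP.map (σ := ((ℕ × PCirc) × ℕ) × ℕ) (eσ := pairE (pairE (pairE unE pcE) natE) natE) (eα := natE) (eβ := bitE)
    (g := fun q => d3 q.1.1.1.1 q.1.1.1.2 q.1.1.2 q.1.2 q.2) hd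
  have hrow := hin.comp ((CodeFP.id (pairE (pairE (pairE unE pcE) natE) natE)).pair (urange.comp (fst (pairE (pairE unE pcE) natE) natE).fst'.fst'))
  have hmid := CodeFP.map (σ := (ℕ × PCirc) × ℕ) (eσ := pairE (pairE unE pcE) natE) (eα := natE) (eβ := bitsE)
    (g := fun q => (List.range q.1.1.1).map fun k => d3 q.1.1.1 q.1.1.2 q.1.2 q.2 k) (hrow.congr fun _ => rfl)
  have hmat := hmid.comp ((CodeFP.id (pairE (pairE unE pcE) natE)).pair (urange.comp (fst (pairE unE pcE) natE).fst'))
  have hout := CodeFP.map (σ := ℕ × PCirc) (eσ := pairE unE pcE) (eα := natE) (eβ := matE)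
    (g := fun q => (List.range q.1.1).map fun j => (List.range q.1.1).map fun k => d3 q.1.1 q.1.2 q.2 j k) (hmat.congr fun _ => rfl)
  exact (hout.comp ((CodeFP.id _).pair (urange.comp (fst _ _)))).congr fun _ => rfl

/-- The unit slices on codes: `(n, T) ↦ unitSlices n T`. [cite: AroraBarak2009, §1.3] -/
theorem unitSlices_codeFP : CodeFP (pairE unE tenE) (rawE matE) (fun t => unitSlices t.1 t.2) := by
  have hg := sliceT_codeFP.comp ((fst (pairE unE tenE) natE).fst'.pair ((fst (pairE unE tenE) natE).snd'.pair
    (unitL_codeFP.comp ((fst (pairE unE tenE) natE).fst'.pair (snd _ _)))))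
  have hm := CodeFP.map (σ := ℕ × Ten) (eσ := pairE unE tenE) (eα := natE) (eβ := matE)
    (g := fun q => sliceT q.1.1 q.1.2 (unitL q.1.1 q.2)) hg
  exact (hm.comp ((CodeFP.id _).pair (urange.comp (fst _ _)))).congr fun _ => rfl

/-- **The context on codes**: `(n, (c₀, c₁)) ↦ ctxOf n c₀ c₁`. [cite: AroraBarak2009, §1.3] -/
theorem ctxOf_codeFP : CodeFP (pairE unE (pairE pcE pcE)) ctxE (fun t => ctxOf t.1 t.2.1 t.2.2) := by
  have hn : CodeFP (pairE unE (pairE pcE pcE)) unE (fun t => t.1) := fst _ _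
  have hc0 : CodeFP (pairE unE (pairE pcE pcE)) pcE (fun t => t.2.1) := (snd _ _).fst'
  have hc1 : CodeFP (pairE unE (pairE pcE pcE)) pcE (fun t => t.2.2) := (snd _ _).snd'
  have hm := unOfNatMin.comp (hn.pair (natDiv.comp ((natOfUn.comp hn).pair (const _ 2))))
  have hb := (unPoly budP).comp hn
  have hT1 := tensorOf_codeFP.comp (hn.pair hc1)
  have hT0 := tensorOf_codeFP.comp (hn.pair hc0)
  have hBs := unitSlices_codeFP.comp (hn.pair hT1)
  have hAs := unitSlices_codeFP.comp (hn.pair hT0)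
  refine ((hn.pair (hm.pair (hb.pair (hc1.pair (hT1.pair (hBs.pair hAs))))))).congr fun t => ?_
  simp only [id, ctxOf, min_eq_left (Nat.div_le_self t.1 2)]

/-- **The finder on mirror-instance codes**: `t ↦ findCore t |code t|`. [cite: AroraBarak2009, §1.3] -/
theorem findCore_codeFP : CodeFP instE matE (fun t => findCore t (instE t).length) := by
  have hL1 := unSucc.comp instLen_codeFP
  have hk := natEq.comp (instK_codeFP.pair (const instE 2))
  have hg := natLeUn.comp (instN_codeFP.pair hL1)
  have hne := unOfNatMin.comp (hL1.pair instN_codeFP)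
  have hrun := runCtx_codeFP.comp (ctxOf_codeFP.comp (hne.pair ((circAtC 0).pair (circAtC 1))))
  refine ((hk.and hg).ite hrun (const _ [])).congr fun t => ?_
  simp only [findCore, nEff]

/-- **The finder on genuine instance codes**, output as the register code of its rows:
`encode I ↦ findCore (instOf I) |encode I|`. [cite: AroraBarak2009, §1.3] -/
theorem findI_codeFP : CodeFP KForrelationInstance.encode (rawE strE) (fun I => findCore (instOf I) I.encode.length) := by
  have hrows : CodeFP matE (rawE strE) (fun L : Mat => L) := (map₀ bitsToStr).congr fun L => List.map_id' L
  have h := hrows.comp (findCore_codeFP.comp instOf_codeFP)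
  refine h.congr fun I => ?_
  simp only [encode_eq]

/-- **The finder `findV2`**: a polynomial-time string function agreeing with `findCore` on instance codes
(by choice from `findI_codeFP`, as `CubicDequant.accF`). [cite: AroraBarak2009, §1.3] -/
def findV2 : List Bool → List Bool := Classical.choose findI_codeFP

/-- **`findV2 ∈ FP`** (registered sub-goal of stmt-QuantumAdvantage-13932, line `dual-pingpong-frame`).
[cite: AroraBarak2009, §1.3] -/
theorem findV2_mem_FP : findV2 ∈ FP := (Classical.choose_spec findI_codeFP).1

/-! ### Soundness: a non-empty output spans a certified M-subspace -/

section Sound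

open Finset
open Literature.Computability.QuantumComplexity.BuzetChailloux (bxor zeroVec)
open Literature.Computability.Complexity.F2Elim (rowSpan)
open Literature.Computability.Complexity.LowDegree (xorVec)
open QuadSampler (bz zb bz_zb bz_injective bz_xorVec bz_zeroV zeroV toInput_zeroL toInput_unitL toInput_bxorL)

/-- **The value of `findV2` on instance codes**: the register code of the rows of `findCore`. [folklore] -/
theorem findV2_encode (I : KForrelationInstance) : findV2 I.encode = encList (findCore (instOf I) I.encode.length) := by
  refine ((Classical.choose_spec findI_codeFP).2 I).trans ?_
  show encList ((findCore (instOf I) I.encode.length).map id) = _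
  rw [List.map_id]

/-- **A non-empty output passed the guard and `MMReadout.certOK`.** [cite: Carlet2020, Prop. 54] -/
theorem certOK_of_findCore {t : Inst} {ℓ : ℕ} {L : Mat} (h : findCore t ℓ = L) (hL : L ≠ []) :
    t.1 ≤ ℓ + 1 ∧ certOK (nEff t ℓ) (circAt t 1) L = true := by
  unfold findCore at h
  split_ifs at h with hg
  · simp only [Bool.and_eq_true, decide_eq_true_eq] at hg
    refine ⟨hg.2, ?_⟩
    unfold runCtx outRows at h
    split_ifs at h with hc
    · simp only [Bool.and_eq_true] at hc
      rw [← h]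
      exact hc.2
    · exact absurd h.symm hL
  · exact absurd h.symm hL

variable {n : ℕ}

/-- The finite set `V(L)` of the registered signature: the `𝔽₂`-row span of `L` read back as bit vectors.
[folklore] -/
abbrev VL (n : ℕ) (L : List (List Bool)) : Finset (Fin n → Bool) :=
  @Finset.filter (Fin n → Bool) (fun v => (fun i => if v i then (1 : ZMod 2) else 0) ∈ F2Elim.rowSpan n L) (Classical.decPred _) Finset.univ

/-- Membership in `V(L)`: the `𝔽₂`-reading lies in the row span. [folklore] -/
theorem mem_VL_iff (L : List (List Bool)) (v : Fin n → Bool) : v ∈ VL n L ↔ bz v ∈ rowSpan n L := by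
  simp only [Finset.mem_filter, Finset.mem_univ, true_and]
  exact Iff.rfl

/-- `0 ∈ V(L)`. [folklore] -/
theorem zeroVec_mem_VL (L : List (List Bool)) : (zeroVec : Fin n → Bool) ∈ VL n L :=
  (mem_VL_iff L _).2 (by rw [show (zeroVec : Fin n → Bool) = zeroV from rfl, bz_zeroV]; exact Submodule.zero_mem _)

/-- `V(L)` is closed under `⊕`. [folklore] -/
theorem bxor_mem_VL {L : List (List Bool)} {x y : Fin n → Bool} (hx : x ∈ VL n L) (hy : y ∈ VL n L) : bxor x y ∈ VL n L :=
  (mem_VL_iff L _).2 (by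
    rw [show bxor x y = xorVec x y from rfl, bz_xorVec]
    exact Submodule.add_mem _ ((mem_VL_iff L x).1 hx) ((mem_VL_iff L y).1 hy))

/-- **`|V(L)| = 2^{rank L}`**: `V(L)` is in bijection (`bz`) with the row span, a subspace of `𝔽₂ⁿ` of dimension
the number of pivots of the reduced form. [cite: KnuthTAOCP2, §4.6.2 Algorithm N] -/
theorem card_VL (n : ℕ) (L : List (List Bool)) : (VL n L).card = 2 ^ npiv n (rrun n L) := by
  classical
  have h1 : (VL n L).card = (univ.filter fun t : Fin n → ZMod 2 => t ∈ rowSpan n L).card := by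
    refine Finset.card_bij (fun v _ => bz v) (fun v hv => ?_) (fun v₁ _ v₂ _ h => bz_injective h) (fun t ht => ⟨zb t, ?_, bz_zb t⟩)
    · exact Finset.mem_filter.2 ⟨Finset.mem_univ _, (mem_VL_iff L v).1 hv⟩
    · exact (mem_VL_iff L _).2 (by rw [bz_zb]; exact (Finset.mem_filter.1 ht).2)
  have h2 : (univ.filter fun t : Fin n → ZMod 2 => t ∈ rowSpan n L).card = Fintype.card (rowSpan n L) :=
    (Fintype.card_of_subtype _ fun t => by simp only [Finset.mem_filter, Finset.mem_univ, true_and]).symm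
  rw [h1, h2, Module.card_eq_pow_finrank (K := ZMod 2), ZMod.card, F2Elim.finrank_rowSpan_eq_card_pivs, npiv,
    F2Elim.length_filter_isPiv]

/-- **Soundness of `findV2`** (registered sub-goal of stmt-QuantumAdvantage-13932, line `dual-pingpong-frame`):
on the code of a two-circuit instance with cubic circuits, a NON-EMPTY output `L` of `findV2` spans an
M-subspace of `g = C₁`: `V(L) ∋ 0` is `⊕`-closed, `|V(L)|² = 2ⁿ`, and all second differences of `g` along
`V(L)` vanish. Proof: the output rule only releases rows passing `MMReadout.certOK` (`certOK_of_findCore`);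
rank `n/2` gives the count (`card_VL`), and the unit-point certificate gives the vanishing on the whole span
for a cubic `g` (`stub_certify`). [cite: Carlet2020, Prop. 54] -/
theorem findV2_sound : ∀ (I : KForrelationInstance) (hk : I.k = 2) (L : List (List Bool)), (∀ i, IsDegLeFun 3 (I.C i).eval) → findV2 I.encode = encList L → L ≠ [] → ((zeroVec ∈ (@Finset.filter (Fin (I.n) → Bool) (fun v => (fun i => if v i then (1 : ZMod 2) else 0) ∈ F2Elim.rowSpan (I.n) L) (Classical.decPred _) Finset.univ) ∧ ∀ x ∈ (@Finset.filter (Fin (I.n) → Bool) (fun v => (fun i => if v i then (1 : ZMod 2) else 0) ∈ F2Elim.rowSpan (I.n) L) (Classical.decPred _) Finset.univ), ∀ y ∈ (@Finset.filter (Fin (I.n) → Bool) (fun v => (fun i => if v i then (1 : ZMod 2) else 0) ∈ F2Elim.rowSpan (I.n) L) (Classical.decPred _) Finset.univ), bxor x y ∈ (@Finset.filter (Fin (I.n) → Bool) (fun v => (fun i => if v i then (1 : ZMod 2) else 0) ∈ F2Elim.rowSpan (I.n) L) (Classical.decPred _) Finset.univ)) ∧ ((((@Finset.filter (Fin (I.n)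 → Bool) (fun v => (fun i => if v i then (1 : ZMod 2) else 0) ∈ F2Elim.rowSpan (I.n) L) (Classical.decPred _) Finset.univ)).card : ℝ) ^ 2 = (2 : ℝ) ^ (I.n)) ∧ (∀ u ∈ (@Finset.filter (Fin (I.n) → Bool) (fun v => (fun i => if v i then (1 : ZMod 2) else 0) ∈ F2Elim.rowSpan (I.n) L) (Classical.decPred _) Finset.univ), ∀ v ∈ (@Finset.filter (Fin (I.n) → Bool) (fun v => (fun i => if v i then (1 : ZMod 2) else 0) ∈ F2Elim.rowSpan (I.n) L) (Classical.decPred _) Finset.univ), ∀ x, ((I.C (Fin.cast hk.symm 1)).eval x ^^ (I.C (Fin.cast hk.symm 1)).eval (bxor x u) ^^ (I.C (Fin.cast hk.symm 1)).eval (bxor x v) ^^ (I.C (Fin.cast hk.symm 1)).eval (bxor x (bxor u v))) = false)) := by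
  intro I hk L hdeg hfind hL
  rw [findV2_encode] at hfind
  have hLeq : findCore (instOf I) I.encode.length = L := by
    have h := congrArg Brick.decNil hfind
    rwa [Brick.decNil_encList, Brick.decNil_encList] at h
  obtain ⟨hn, hcert⟩ := certOK_of_findCore hLeq hL
  have hnI : nEff (instOf I) I.encode.length = I.n := min_eq_left hn
  have hc1 : circAt (instOf I) 1 = pcircOf (I.C (Fin.cast hk.symm 1)) := circAt_instOf I (Fin.cast hk.symm 1)
  rw [hnI, hc1] at hcert
  simp only [certOK, Bool.and_eq_true, decide_eq_true_eq, List.all_eq_true, Bool.not_eq_true'] at hcert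
  obtain ⟨hrank, haff⟩ := hcert
  -- the unit-point certificate, read in `{0,1}ⁿ` (`g := (I.C 1).eval`)
  have hrows : ∀ r ∈ L, ∀ s ∈ L, ∀ y : Fin I.n → Bool, (y = zeroVec ∨ ∃ i : Fin I.n, y = fun j => decide (j = i)) →
      ((I.C (Fin.cast hk.symm 1)).eval y ^^ (I.C (Fin.cast hk.symm 1)).eval (bxor y (fun i => r.getD i false)) ^^
        (I.C (Fin.cast hk.symm 1)).eval (bxor y (fun i => s.getD i false)) ^^
        (I.C (Fin.cast hk.symm 1)).eval (bxor y (bxor (fun i => r.getD i false) (fun i => s.getD i false)))) = false := by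
    intro r hr s hs y hy
    have key : ∀ yl ∈ unitPts I.n, ((I.C (Fin.cast hk.symm 1)).eval (toInput I.n yl) ^^
        (I.C (Fin.cast hk.symm 1)).eval (bxor (toInput I.n yl) (toInput I.n r)) ^^
        (I.C (Fin.cast hk.symm 1)).eval (bxor (toInput I.n yl) (toInput I.n s)) ^^
        (I.C (Fin.cast hk.symm 1)).eval (bxor (toInput I.n yl) (bxor (toInput I.n r) (toInput I.n s)))) = false := by
      intro yl hyl
      have h := haff (r, s) (List.pair_mem_product.2 ⟨hr, hs⟩) yl hyl
      simp only [d2, evalP_pcircOf_eq, toInput_bxorL] at h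
      exact h
    rcases hy with rfl | ⟨i, rfl⟩
    · have h := key (zeroL I.n) List.mem_cons_self
      rwa [toInput_zeroL] at h
    · have h := key (unitL I.n i) (List.mem_cons_of_mem _ (List.mem_map.2 ⟨i, List.mem_range.2 i.isLt, rfl⟩))
      rwa [toInput_unitL] at h
  refine ⟨⟨zeroVec_mem_VL L, fun x hx y hy => bxor_mem_VL hx hy⟩, ?_, fun u hu v hv x => ?_⟩
  · rw [card_VL]
    push_cast
    rw [← pow_mul]
    exact congrArg (fun k : ℕ => (2 : ℝ) ^ k) (by omega)
  · exact SignedCubicForrelationInPrBPP.stub_certify I.n _ (hdeg (Fin.cast hk.symm 1)) L hrows u v ((mem_VL_iff L u).1 hu)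
      ((mem_VL_iff L v).1 hv) x

end Sound

end Summit.QuantumAdvantage.QuantumAdvantage.Theorems.SignedExactCubicForrelationNotPrBPP.FinderMachine

end
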